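import Mathlib
import HarnessLib
import Summits.NavierStokesRegularity.NavierStokesRegularity.Theorems.PoloidalWindowRigidity.Negative.TriWaveProfile
import Summits.NavierStokesRegularity.NavierStokesRegularity.Theorems.PoloidalWindowRigidity.Negative.ResidueRev9False
import Summits.NavierStokesRegularity.NavierStokesRegularity.Theorems.PoloidalWindowRigidity.Negative.DriftProfileNoPeriod

/-!
# Crux `PoloidalWindowRigidity` (K2, stmt-NavierStokesRegularity-19708) — negative side:
# genericity clauses of the residue stub S2⁗ for the three-wave profile, II: screw motions and spiral self-similarity

Negative-side support (refuter seat ns-regularity-refuter1 gen 2; D-0081 §C), sequel of `…Negative.TriWaveGenericity`.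

* (14) `not_screwInvariant_triProfile`: for every pitch `κ ≠ 0` and every vertical axis through `c` some screw motion
  moves the slice `t = −1`: the full turn (shift `2π/κ`, trivial rotation) forces `cos(2π/κ) = 1`, and then the half
  turn (shift `π/κ`, rotation by `π`), read in the components `0` and `2` at the axis point `c` and at `c + (π/2)e₀`,
  forces `cos γ = sin γ = 0`, `γ = c₀ + c₂`;
* (vi′) `not_spiralSelfSimilar_triProfile`: no discrete spiral parabolic self-similarity about any centre with any
  angular velocity: for `κ ≠ 0` the quarter turn `r = π/(2κ)` (first component `≥ −2` against `−4`), for `κ = 0` the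
  scaling `r = π/2` on the slice `s = −1/a²`, `a = (1 + |c₁| + |c₂|)^{-1}` (the residual phase
  `a(e^{−π/2} − 1)(c₁ − c₂)` has modulus `< 1`, so the shifted second component is `< 4 = T₁(0)`).
The slice bookkeeping (`cellAmp_exp_sq_mul`, `rescaled_shift_basePoint`, …) is reused from
`…Negative.ResidueRev9False`.

WHAT THIS IS NOT: not a claim about Navier–Stokes — kinematics of an explicit profile. [folklore]
-/

noncomputable section

-- the summit and its single sub-problem share the name (CONVENTIONS §1), as in every Theorems file
set_option linter.dupNamespace false

namespace Summit.NavierStokesRegularity.NavierStokesRegularity.Theorems.PoloidalWindowRigidity.Negative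

open MeasureTheory Set Function Filter Topology Metric
open scoped RealInnerProductSpace InnerProductSpace ENNReal NNReal
open Literature.Analysis Literature.Analysis.FluidPDE


/-! ### Screw motions and spiral self-similarity -/

/-- (14) invariant under no vertical screw motion with pitch `κ ≠ 0` about any vertical axis (slice `t = −1`):
the shift `2π/κ` with trivial rotation forces `cos(2π/κ) = 1`; then the shift `π/κ` with the half-turn, read at
the axis point `c` and at `c + (π/2)e₀` in the components `0` and `2`, forces `cos γ = sin γ = 0`
(`γ = c₀ + c₂`). [folklore] -/
theorem not_screwInvariant_triProfile (κ : ℝ) (hκ : κ ≠ 0) (c : EuclideanSpace ℝ (Fin 3)) :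
    ∃ s < 0, ∃ (a : ℝ) (y : EuclideanSpace ℝ (Fin 3)),
      triProfile s (c + rotZ (κ * a) (y - c) + a • (EuclideanSpace.single (2 : Fin 3) (1 : ℝ))) ≠ rotZ (κ * a)
          (triProfile s y) := by
  by_contra hcon
  push Not at hcon
  have H : ∀ (a : ℝ) (y : EuclideanSpace ℝ (Fin 3)), triField (c + rotZ (κ * a) (y - c) + a • (EuclideanSpace.single
      (2 : Fin 3) (1 : ℝ))) = rotZ (κ * a) (triField y) := by
    intro a y
    simpa only [triProfile_neg_one] using hcon (-1) (by norm_num) a y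
  -- step 1: the full turn
  have hk1 : κ * (2 * Real.pi / κ) = 2 * Real.pi := by field_simp
  have h1 := H (2 * Real.pi / κ) 0
  rw [hk1, rotZ_eq_self_of_cos_eq_one Real.cos_two_pi Real.sin_two_pi,
    rotZ_eq_self_of_cos_eq_one Real.cos_two_pi Real.sin_two_pi, zero_sub, add_neg_cancel, zero_add] at h1
  have h1c := congrArg (fun w : EuclideanSpace ℝ (Fin 3) => w 0) h1
  simp [triField_apply_zero] at h1c
  -- h1c : Real.cos (2 * Real.pi / κ) = 1
  -- step 2: the half turn
  set α := Real.pi / κ with hα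
  have h2α : 2 * Real.pi / κ = 2 * α := by rw [hα]; ring
  rw [h2α, Real.cos_two_mul] at h1c
  have hsin : Real.sin α = 0 := by nlinarith [Real.sin_sq_add_cos_sq α]
  have hk2 : κ * α = Real.pi := by rw [hα]; field_simp
  have hca : ∀ θ : ℝ, Real.cos (θ + α) = Real.cos α * Real.cos θ := by
    intro θ; rw [Real.cos_add, hsin]; ring
  have hcs : ∀ θ : ℝ, Real.cos (θ - α) = Real.cos α * Real.cos θ := by
    intro θ; rw [Real.cos_sub, hsin]; ring
  have hA := H α c
  have hB := H α (c + (Real.pi / 2) • (EuclideanSpace.single (0 : Fin 3) (1 : ℝ)))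
  rw [hk2, sub_self] at hA
  rw [hk2, add_sub_cancel_left] at hB
  have hA0 := congrArg (fun w : EuclideanSpace ℝ (Fin 3) => w 0) hA
  have hA2 := congrArg (fun w : EuclideanSpace ℝ (Fin 3) => w 2) hA
  have hB0 := congrArg (fun w : EuclideanSpace ℝ (Fin 3) => w 0) hB
  have hB2 := congrArg (fun w : EuclideanSpace ℝ (Fin 3) => w 2) hB
  simp [triField_apply_zero, triField_apply_one, triField_apply_two] at hA0 hA2 hB0 hB2
  -- normalise the trigonometry: `cos(θ ± α) = ε cos θ`, `ε = cos α = ±1`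
  have e1 : Real.cos (c 0 + (c 2 + α)) = Real.cos α * Real.cos (c 0 + c 2) := by rw [← add_assoc, hca]
  have e2 : Real.cos (c 1 - (c 2 + α)) = Real.cos α * Real.cos (c 1 - c 2) := by rw [← sub_sub, hcs]
  have e3 : Real.cos (c 1 + (c 2 + α)) = Real.cos α * Real.cos (c 1 + c 2) := by rw [← add_assoc, hca]
  have e4 : Real.cos (c 0 + -(Real.pi / 2) + (c 2 + α)) = Real.cos α * Real.sin (c 0 + c 2) := by
    rw [show c 0 + -(Real.pi / 2) + (c 2 + α) = (c 0 + c 2 - Real.pi / 2) + α by ring, hca,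
      Real.cos_sub_pi_div_two]
  have e5 : Real.cos (c 0 + Real.pi / 2 + c 2) = -Real.sin (c 0 + c 2) := by
    rw [show c 0 + Real.pi / 2 + c 2 = (c 0 + c 2) + Real.pi / 2 by ring, Real.cos_add_pi_div_two]
  rw [e1] at hA0
  rw [e1, e2, e3] at hA2
  rw [e4, e5] at hB0
  rw [e4, e2, e3, e5] at hB2
  have hsq : Real.cos α ^ 2 = 1 ^ 2 := by nlinarith [Real.sin_sq_add_cos_sq α]
  have hγ := Real.sin_sq_add_cos_sq (c 0 + c 2)
  rcases eq_or_eq_neg_of_sq_eq_sq _ _ hsq with hε | hε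
  · rw [hε] at hA0 hB2
    have hX : Real.cos (c 0 + c 2) = 0 := by linarith
    have hY : Real.sin (c 0 + c 2) = 0 := by linarith
    rw [hX, hY] at hγ
    norm_num at hγ
  · rw [hε] at hA2 hB0 hB2
    have hY : Real.sin (c 0 + c 2) = 0 := by linarith
    have hX : Real.cos (c 0 + c 2) = 0 := by linarith
    rw [hX, hY] at hγ
    norm_num at hγ

/-- The parabolic `e^r`-rescaling of the slice `s = −1/a²` of the three-wave profile:
`e^r • v(e^{2r}s, x) = a • T((a/e^r) • x + (2r − 2 log a) • e₁)`. [folklore] -/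
theorem triProfile_rescaled (r : ℝ) {a : ℝ} (ha : 0 < a) (x : EuclideanSpace ℝ (Fin 3)) :
    Real.exp r • triProfile (Real.exp r ^ 2 * -(a ^ 2)⁻¹) x =
      a • triField ((a / Real.exp r) • x + (2 * r - 2 * Real.log a) • (EuclideanSpace.single (1 : Fin 3) (1 : ℝ))) :=
          by
  simp only [triProfile, driftShift, cellAmp_exp_sq_mul r ha, log_exp_sq_mul r ha, smul_smul]
  rw [show Real.exp r * (a / Real.exp r) = a by field_simp]

/-- The slice `s = −1/a²` of the three-wave profile: `v(s, x) = a • T(a • x − 2 log a • e₁)`. [folklore] -/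
theorem triProfile_slice {a : ℝ} (ha : 0 < a) (x : EuclideanSpace ℝ (Fin 3)) :
    triProfile (-(a ^ 2)⁻¹) x = a • triField (a • x + (-(2 * Real.log a)) • (EuclideanSpace.single (1 : Fin 3) (1 :
        ℝ))) := by
  simp only [triProfile, driftShift, cellAmp_neg_inv_sq ha, log_neg_neg_inv_sq a]

/-- (vi′) no discrete (spiral) parabolic self-similarity about any centre `c` with any angular velocity `κ`.
`κ ≠ 0`: the quarter turn `r = π/(2κ)` on the slice `s = −1` at `y = −c` — the first component of the rescaled
side is `2cos(·) ≥ −2`, that of the rotated side is `−4`.  `κ = 0`: `r = π/2` on the slice `s = −1/a²` with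
`a = (1 + |c₁| + |c₂|)^{-1}` — the residual shift `d = a(e^{−π/2} − 1)c + π e₁` has `d₁ − d₂ ∈ (π − 1, π + 1)`,
so `T₁(d) < 4 = T₁(0)`. [folklore] -/
theorem not_spiralSelfSimilar_triProfile (c : EuclideanSpace ℝ (Fin 3)) (κ : ℝ) :
    ∃ r : ℝ, ∃ s < 0, ∃ y : EuclideanSpace ℝ (Fin 3),
      Real.exp r • triProfile (Real.exp r ^ 2 * s) (Real.exp r • rotZ (κ * r) y + c) ≠
        rotZ (κ * r) (triProfile s (y + c)) := by
  by_cases hκ : κ = 0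
  · subst hκ
    have ha : (0 : ℝ) < (1 + |c 1| + |c 2|)⁻¹ := by positivity
    set a : ℝ := (1 + |c 1| + |c 2|)⁻¹ with ha_def
    have hs : -(a ^ 2)⁻¹ < (0 : ℝ) := by
      have : 0 < (a ^ 2)⁻¹ := by positivity
      linarith
    refine ⟨Real.pi / 2, -(a ^ 2)⁻¹, hs, -c + (2 * Real.log a / a) • (EuclideanSpace.single (1 : Fin 3) (1 : ℝ)), ?_⟩
    rw [zero_mul, rotZ_zero, rotZ_zero, triProfile_rescaled _ ha, rescaled_shift_basePoint _ ha,
      triProfile_slice ha, slice_shift_basePoint ha]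
    intro h
    -- the residual horizontal phase
    set μ : ℝ := a * ((Real.exp (Real.pi / 2))⁻¹ - 1) with hμ
    have d1 : (μ • c + (2 * (Real.pi / 2)) • (EuclideanSpace.single (1 : Fin 3) (1 : ℝ)) : EuclideanSpace ℝ (Fin 3))
        1 = μ * c 1 + Real.pi := by
      simp
      ring
    have d2 : (μ • c + (2 * (Real.pi / 2)) • (EuclideanSpace.single (1 : Fin 3) (1 : ℝ)) : EuclideanSpace ℝ (Fin 3))
        2 = μ * c 2 := by simp
    have h1 := congrArg (fun w : EuclideanSpace ℝ (Fin 3) => w 1) (smul_right_injective _ ha.ne' h)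
    simp only [triField_apply_one, d1, d2, PiLp.zero_apply, sub_zero, add_zero, Real.cos_zero] at h1
    have hμa : |μ| < a := by
      have h0 : 0 < (Real.exp (Real.pi / 2))⁻¹ := by positivity
      have h1' : (Real.exp (Real.pi / 2))⁻¹ < 1 := by
        rw [inv_lt_one_iff₀]
        exact Or.inr (Real.one_lt_exp_iff.2 (by positivity))
      rw [hμ, abs_lt]
      constructor <;> nlinarith
    have hsmall : |μ * (c 1 - c 2)| < 1 := by
      rw [abs_mul]
      have hc12 : |c 1 - c 2| ≤ |c 1| + |c 2| := abs_sub _ _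
      have hpos : 0 < 1 + |c 1| + |c 2| := by positivity
      calc |μ| * |c 1 - c 2| ≤ a * (|c 1| + |c 2|) := by
            apply mul_le_mul hμa.le hc12 (abs_nonneg _) ha.le
        _ < 1 := by
            rw [ha_def, inv_mul_lt_iff₀ hpos]
            linarith
    have hx := abs_lt.1 hsmall
    have hne : Real.cos (μ * (c 1 - c 2) + Real.pi) ≠ 1 := by
      rw [Ne, Real.cos_eq_one_iff_of_lt_of_lt (by linarith [Real.pi_gt_three]) (by linarith [Real.pi_gt_three])]
      linarith [Real.pi_gt_three]
    have hlt : Real.cos (μ * (c 1 - c 2) + Real.pi) < 1 := lt_of_le_of_ne (Real.cos_le_one _) hne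
    have hle := Real.cos_le_one (μ * (c 1 + c 2) + Real.pi)
    have e1 : μ * c 1 + Real.pi - μ * c 2 = μ * (c 1 - c 2) + Real.pi := by ring
    have e2 : μ * c 1 + Real.pi + μ * c 2 = μ * (c 1 + c 2) + Real.pi := by ring
    rw [e1, e2] at h1
    linarith
  · -- a genuine rotation: the quarter turn on the slice `s = -1`
    have hk : κ * (Real.pi / (2 * κ)) = Real.pi / 2 := by field_simp
    have hs : -((1 : ℝ) ^ 2)⁻¹ < 0 := by norm_num
    refine ⟨Real.pi / (2 * κ), -((1 : ℝ) ^ 2)⁻¹, hs, -c, ?_⟩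
    rw [hk, triProfile_rescaled _ one_pos, neg_add_cancel, triProfile_slice one_pos, smul_zero, zero_add,
      Real.log_one, mul_zero, neg_zero, zero_smul, one_smul, one_smul]
    intro h
    have hL : ∀ X : EuclideanSpace ℝ (Fin 3), -2 ≤ triField X 0 := fun X => by
      rw [triField_apply_zero]
      linarith [Real.neg_one_le_cos (X 0 + X 2)]
    have hR : (rotZ (Real.pi / 2) (triField 0) : EuclideanSpace ℝ (Fin 3)) 0 = -4 := by
      simp only [rotZ_apply_zero, triField_apply_zero, triField_apply_one, PiLp.zero_apply, add_zero, sub_zero,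
        Real.cos_zero, Real.cos_pi_div_two, Real.sin_pi_div_two]
      norm_num
    have key := (hL _).trans_eq ((congrArg (fun w : EuclideanSpace ℝ (Fin 3) => w 0) h).trans hR)
    norm_num at key

end Summit.NavierStokesRegularity.NavierStokesRegularity.Theorems.PoloidalWindowRigidity.Negative

end
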